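import Summits.HodgeConjecture.CorCM.GenericSexticThreefoldTimesCMHodge
import Literature.AlgebraicGeometry.Pohlmann1968.SeparatingCMFamilies
import Literature.AlgebraicGeometry.Pohlmann1968.SimpleCMAbelianVarietyPowersDivisorGenerated
import HarnessLib

/-!
# A CM field with PAIR FLIPS (generic, any degree) times ANY CM field of SMALLER degree: `Hg(A₀ × A₁) = Hg(A₀) × Hg(A₁)`,
# so the pair is nondegenerate iff the smaller partner is — a generic CM abelian variety times any CM abelian variety of
# smaller dimension

COR-CM (cell `pub-hodgecm2`, binder seat `b16` gen 52, count-neutral claim TOWER-SHADOW, file F5 — CM fields and abelian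
varieties; theorems only, no definition, no named fact, no `sorry`).  NEW as stated, hence under `Summits/`.  HONEST
FRAMING: unconditional statements about pairs of CM types / CM abelian varieties; `HC_CM` is neither used nor asserted.

The degree table for a pair-flip slot `K_{i₁}` (every conjugate pair of embeddings exchanged by an automorphism of `ℂ`
fixing the others — the generic CM fields of every degree `2g`, Galois group `C₂ ≀ 𝔖_g`; `U(Φ_{i₁})` is then IRREDUCIBLE of
dimension `g`, seat b16 gen 41 `irreducible_and_finrank_eq_of_pairFlip`) against a partner `K_{i₀}`:
* `[K_{i₀} : ℚ] < [K_{i₁} : ℚ]` — THIS FILE: `dim U(Φ_{i₀}) ≤ [K_{i₀}:ℚ]/2 < g = dim U(Φ_{i₁})`, so the tree's Schur count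
  `pairwise_of_irreducible_of_finrank_le` (`CMTypeRankIrreducibleSlot` §2) gives NO COMMON CONSTITUENT in both orders, with
  NO hypothesis on the partner field or on the Galois closures (the tree had the sextic case `[K_{i₀}:ℚ] ≤ 4`,
  `isNondegenerateFamily_iff_pairFlipSextic_of_finrank_le_four`, the prime-degree case `PrimeDegreeSlotPairsHodge`, and the
  off-closure case `PairFlipCMFieldOffClosureHodge` — a smaller partner MAY lie inside the closure, e.g. a quartic CM subfield
  of the closure of a generic sextic field);
* `[K_{i₀} : ℚ] = [K_{i₁} : ℚ]` — gen 51 `PairFlipCompanionIsogeny` (additive or isogenous, under compatibility);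
* `K_{i₁} ⊆ K_{i₀}` with relative pair flips — gen 52 `GenericCMSubfieldTowerTypes` (additive unless constant unequal
  multiplicities).

* §1 **`isNondegenerateFamily_iff_pairFlip_of_finrank_lt`** — `I = {i₀, i₁}`, `K_{i₁}` pair-flip, `[K_{i₀}:ℚ] < [K_{i₁}:ℚ]`:
  the pair is nondegenerate IFF `Φ_{i₀}` is; **`cmFamilyRank_add_card_eq_pairFlip_of_finrank_lt`** — the rank is ALWAYS
  additive (`Hg(A₀ × A₁) = Hg(A₀) × Hg(A₁)`), whatever the types.
* §2 abelian varieties: **`hodgeConjectureFor_prod_pairFlip_of_finrank_lt`** — the Hodge conjecture with `B• = D•` on every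
  `A₀^a × A₁^b` when `Φ_{i₀}` is nondegenerate, UNCONDITIONALLY; **`hodgeConjectureFor_prod_pairFlip_of_dim_lt`** — the same
  read with `dim A₀ < dim A₁`; **`forall_prod_hodgeClassSpan_eq_iff_pairFlip_of_finrank_lt`** — simple non-isogenous
  realisations: `B• = D•` on ALL products IFF `Φ_{i₀}` is nondegenerate (else an exceptional class on some product,
  `exists_exceptional_prod_pairFlip_of_finrank_lt`).

## References

* [Gordon1999HodgeAVSurvey] B. B. Gordon, *A survey of the Hodge conjecture for abelian varieties*, §3 Theorem (Imai,
  Murty) with proof, 7.4–7.7, 10.10.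
* [Dodson1984] B. Dodson, *The structure of Galois groups of CM-fields*, Trans. AMS 283 (1984), §1.1, §5.1.2.
* [Serre1977] J.-P. Serre, *Linear Representations of Finite Groups*, GTM 42, §2.2 Prop. 4.
* [Shimura1998] G. Shimura, *Abelian Varieties with Complex Multiplication and Modular Functions*, §5.2, §18.1.
-/

noncomputable section

open CategoryTheory CategoryTheory.Limits NumberField Module

namespace Summit.HodgeConjecture.CorCM

open Literature.NumberTheory.ComplexMultiplication
open Literature.AlgebraicGeometry.Motives (AbelianVariety CMType)
open Literature.AlgebraicGeometry.HodgeTheory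
open Literature.AlgebraicGeometry.ComplexMultiplication (IsCMTypeRealisation)
open Literature.AlgebraicGeometry.VanGeemen1994 (hodgeClassSpan)
open Literature.AlgebraicGeometry.Pohlmann1968
open Literature.Barriers.HodgeConjecture (divisorClassesSpan)
open scoped Classical

variable {I : Type} {K : I → Type} [∀ i, Field (K i)] [∀ i, NumberField (K i)] [∀ i, IsCMField (K i)] [Fintype I]
  [DecidableEq I] {Φ : ∀ i, CMType (K i)} {i₀ i₁ : I}

/-! ### §1 CM types: no common constituent by a dimension count -/

section Types

variable [Nonempty I]

omit [Fintype I] [DecidableEq I] [Nonempty I] in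
/-- **No common constituent, both orders**, between a pair-flip slot `K_{i₁}` and ANY slot `K_{i₀}` of smaller degree:
`dim U(Φ_{i₀}) ≤ [K_{i₀}:ℚ]/2 < [K_{i₁}:ℚ]/2 = dim U(Φ_{i₁})` with `U(Φ_{i₁})` irreducible.
[cite: Serre1977, §2.2 Prop. 4 (proof)] [cite: Dodson1984, §5.1.2 Theorem] -/
theorem pairwise_pairFlip_of_finrank_lt (h01 : i₀ ≠ i₁) (hI : ∀ j, j = i₀ ∨ j = i₁)
    (hflip : ∀ s : K i₁ →+* ℂ, ∃ σ : ℂ ≃+* ℂ, σ • s = (starRingAut : ℂ ≃+* ℂ) • s ∧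
      ∀ t : K i₁ →+* ℂ, t ≠ s → t ≠ (starRingAut : ℂ ≃+* ℂ) • s → σ • t = t)
    (hlt : finrank ℚ (K i₀) < finrank ℚ (K i₁)) :
    ∀ i j, i ≠ j → ∀ P : Submodule ℚ ((K i →+* ℂ) → ℚ), P ≤ antiSpan (ℂ ≃+* ℂ) (Φ i).1 →
      (∀ g : ℂ ≃+* ℂ, ∀ f ∈ P, (fun x => f (g • x)) ∈ P) →
      ∀ T : ((K i →+* ℂ) → ℚ) →ₗ[ℚ] ((K j →+* ℂ) → ℚ),
        (∀ g : ℂ ≃+* ℂ, ∀ f ∈ P, T (fun x => f (g • x)) = fun y => T f (g • y)) →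
        (∀ f ∈ P, T f ∈ antiSpan (ℂ ≃+* ℂ) (Φ j).1) → (∀ f ∈ P, T f = 0 → f = 0) → P = ⊥ := by
  obtain ⟨hirr, hdim₁, -⟩ := irreducible_and_finrank_eq_of_pairFlip (Φ := Φ) hflip
  have hle₀ := finrank_antiSpan_le_finrank_div_two (Φ := Φ) i₀
  have hev₀ := two_mul_card_filter_mem_cmType (Φ i₀)
  have hev₁ := two_mul_card_filter_mem_cmType (Φ i₁)
  have hlt' : finrank ℚ (antiSpan (ℂ ≃+* ℂ) (Φ i₀).1) < finrank ℚ (antiSpan (ℂ ≃+* ℂ) (Φ i₁).1) := by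
    rw [hdim₁]; omega
  have hp := pairwise_of_irreducible_of_finrank_le (G := ℂ ≃+* ℂ) (Φ := fun i => (Φ i).1) (i := i₀) (j := i₁)
    hirr hlt'.le (fun h => absurd h hlt'.ne)
  intro i j hij
  rcases hI i with rfl | rfl <;> rcases hI j with rfl | rfl
  · exact absurd rfl hij
  · exact hp.1
  · exact hp.2
  · exact absurd rfl hij

/-- **A pair-flip slot times ANY CM field of smaller degree: the pair is nondegenerate IFF the partner type is** —
`I = {i₀, i₁}`, `K_{i₁}` with pair flips (generic of degree `2g`), `[K_{i₀} : ℚ] < 2g`, no other hypothesis (the partner may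
lie inside the Galois closure of `K_{i₁}`). [cite: Gordon1999HodgeAVSurvey, §3 Theorem and 7.5–7.7]
[cite: Dodson1984, §5.1.2 Theorem] -/
theorem isNondegenerateFamily_iff_pairFlip_of_finrank_lt (h01 : i₀ ≠ i₁) (hI : ∀ j, j = i₀ ∨ j = i₁)
    (hflip : ∀ s : K i₁ →+* ℂ, ∃ σ : ℂ ≃+* ℂ, σ • s = (starRingAut : ℂ ≃+* ℂ) • s ∧
      ∀ t : K i₁ →+* ℂ, t ≠ s → t ≠ (starRingAut : ℂ ≃+* ℂ) • s → σ • t = t)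
    (hlt : finrank ℚ (K i₀) < finrank ℚ (K i₁)) :
    CMAlgebra.IsNondegenerateFamily Φ ↔ IsNondegenerate (Φ i₀) := by
  obtain ⟨-, -, hnd₁⟩ := irreducible_and_finrank_eq_of_pairFlip (Φ := Φ) hflip
  rw [isNondegenerateFamily_iff_forall_of_pairwise Φ (pairwise_pairFlip_of_finrank_lt h01 hI hflip hlt)]
  exact ⟨fun h => h i₀, fun h i => by rcases hI i with rfl | rfl <;> assumption⟩

/-- **The rank is ALWAYS additive**: `rank(Φ₀, Φ₁) + 2 = rank Φ₀ + rank Φ₁ + 1` (`Hg(A₀ × A₁) = Hg(A₀) × Hg(A₁)`) for a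
pair-flip slot and any slot of smaller degree, whatever the two types. [cite: Gordon1999HodgeAVSurvey, §3 Theorem (1)] -/
theorem cmFamilyRank_add_card_eq_pairFlip_of_finrank_lt (h01 : i₀ ≠ i₁) (hI : ∀ j, j = i₀ ∨ j = i₁)
    (hflip : ∀ s : K i₁ →+* ℂ, ∃ σ : ℂ ≃+* ℂ, σ • s = (starRingAut : ℂ ≃+* ℂ) • s ∧
      ∀ t : K i₁ →+* ℂ, t ≠ s → t ≠ (starRingAut : ℂ ≃+* ℂ) • s → σ • t = t)
    (hlt : finrank ℚ (K i₀) < finrank ℚ (K i₁)) :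
    CMAlgebra.cmFamilyRank Φ + Fintype.card I = (∑ i, cmTypeRank (Φ i)) + 1 :=
  cmFamilyRank_add_card_eq_of_pairwise Φ (pairwise_pairFlip_of_finrank_lt h01 hI hflip hlt)

end Types

/-! ### §2 Abelian varieties -/

section Varieties

variable [Nonempty I] {A : I → AbelianVariety ℂ} {ι : ∀ i, 𝓞 (K i) →+* End (A i)}
  {θ : ∀ i, K i →+* Module.End ℂ (complexBetti (A i).X 1)}

/-- **The Hodge conjecture on every `A₀^a × A₁^b`** (every `⨁_{j<N} A_{π j}`), with `B• = D•` there, for realisations of a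
NONDEGENERATE type of a CM field of smaller degree and any type of a pair-flip CM field — UNCONDITIONALLY.
[cite: Gordon1999HodgeAVSurvey, 7.5 and 10.10] -/
theorem hodgeConjectureFor_prod_pairFlip_of_finrank_lt (h01 : i₀ ≠ i₁) (hI : ∀ j, j = i₀ ∨ j = i₁)
    (hflip : ∀ s : K i₁ →+* ℂ, ∃ σ : ℂ ≃+* ℂ, σ • s = (starRingAut : ℂ ≃+* ℂ) • s ∧
      ∀ t : K i₁ →+* ℂ, t ≠ s → t ≠ (starRingAut : ℂ ≃+* ℂ) • s → σ • t = t)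
    (hlt : finrank ℚ (K i₀) < finrank ℚ (K i₁)) (hnd : IsNondegenerate (Φ i₀))
    (hA : ∀ i, IsCMTypeRealisation (Φ i) (A i) (ι i) (θ i)) {N : ℕ} (π : Fin N → I) :
    HodgeConjectureFor (⨁ fun j : Fin N => A (π j)).dim (⨁ fun j : Fin N => A (π j)).X ∧
      ∀ m : ℕ, hodgeClassSpan (⨁ fun j : Fin N => A (π j)).dim (⨁ fun j : Fin N => A (π j)).X m =
        divisorClassesSpan (⨁ fun j : Fin N => A (π j)).X (⨁ fun j : Fin N => A (π j)).dim m :=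
  have h := (isNondegenerateFamily_iff_pairFlip_of_finrank_lt h01 hI hflip hlt).2 hnd
  ⟨h.hodgeConjectureFor_prod hA π, fun m => h.hodgeClassSpan_prod_eq_divisorClassesSpan hA π m⟩

/-- **Dimension reading: a GENERIC CM abelian variety `A₁` (pair-flip endomorphism field) times ANY CM abelian variety
`A₀` of SMALLER dimension and nondegenerate type** — the Hodge conjecture with `B• = D•` on every `A₀^a × A₁^b`,
UNCONDITIONALLY (e.g. a generic CM fourfold times any CM elliptic curve, simple CM surface or simple CM threefold).
[cite: Gordon1999HodgeAVSurvey, 7.5 and 10.10] [cite: Shimura1998, §5.2] -/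
theorem hodgeConjectureFor_prod_pairFlip_of_dim_lt (h01 : i₀ ≠ i₁) (hI : ∀ j, j = i₀ ∨ j = i₁)
    (hflip : ∀ s : K i₁ →+* ℂ, ∃ σ : ℂ ≃+* ℂ, σ • s = (starRingAut : ℂ ≃+* ℂ) • s ∧
      ∀ t : K i₁ →+* ℂ, t ≠ s → t ≠ (starRingAut : ℂ ≃+* ℂ) • s → σ • t = t)
    (hA : ∀ i, IsCMTypeRealisation (Φ i) (A i) (ι i) (θ i)) (hdim : (A i₀).dim < (A i₁).dim)
    (hnd : IsNondegenerate (Φ i₀)) {N : ℕ} (π : Fin N → I) :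
    HodgeConjectureFor (⨁ fun j : Fin N => A (π j)).dim (⨁ fun j : Fin N => A (π j)).X ∧
      ∀ m : ℕ, hodgeClassSpan (⨁ fun j : Fin N => A (π j)).dim (⨁ fun j : Fin N => A (π j)).X m =
        divisorClassesSpan (⨁ fun j : Fin N => A (π j)).X (⨁ fun j : Fin N => A (π j)).dim m := by
  have hlt : finrank ℚ (K i₀) < finrank ℚ (K i₁) := by
    rw [finrank_eq_two_mul_dim_of_isCMTypeRealisation (hA i₀), finrank_eq_two_mul_dim_of_isCMTypeRealisation (hA i₁)]
    omega
  exact hodgeConjectureFor_prod_pairFlip_of_finrank_lt h01 hI hflip hlt hnd hA π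

/-- **SIMPLE, NON-ISOGENOUS realisations: `B• = D•` on ALL products `A₀^a × A₁^b` IFF `Φ_{i₀}` is nondegenerate** (the
pair-flip member is always nondegenerate and the rank is additive). [cite: Gordon1999HodgeAVSurvey, 7.5 and 7.6.1] -/
theorem forall_prod_hodgeClassSpan_eq_iff_pairFlip_of_finrank_lt (h01 : i₀ ≠ i₁) (hI : ∀ j, j = i₀ ∨ j = i₁)
    (hflip : ∀ s : K i₁ →+* ℂ, ∃ σ : ℂ ≃+* ℂ, σ • s = (starRingAut : ℂ ≃+* ℂ) • s ∧
      ∀ t : K i₁ →+* ℂ, t ≠ s → t ≠ (starRingAut : ℂ ≃+* ℂ) • s → σ • t = t)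
    (hlt : finrank ℚ (K i₀) < finrank ℚ (K i₁)) (hA : ∀ i, IsCMTypeRealisation (Φ i) (A i) (ι i) (θ i))
    (hs : ∀ i, (A i).IsSimple) (hniso : ∀ i i', i ≠ i' → ¬ AbelianVariety.IsIsogenous (A i) (A i')) :
    (∀ (N : ℕ) (π : Fin N → I) (m : ℕ),
      hodgeClassSpan (⨁ fun j : Fin N => A (π j)).dim (⨁ fun j : Fin N => A (π j)).X m =
        divisorClassesSpan (⨁ fun j : Fin N => A (π j)).X (⨁ fun j : Fin N => A (π j)).dim m) ↔
      IsNondegenerate (Φ i₀) := by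
  rw [← CMAlgebra.isNondegenerateFamily_iff_forall_prod_hodgeClassSpan_eq
    (CMAlgebra.isSeparatingFamily_of_isSimple_of_pairwise_not_isIsogenous hA hs hniso) hA]
  exact isNondegenerateFamily_iff_pairFlip_of_finrank_lt h01 hI hflip hlt

/-- **… and a DEGENERATE partner type puts an exceptional Hodge class on some `A₀^a × A₁^b`** (simple, non-isogenous
realisations; a rational `(m,m)`-class outside `Dᵐ ⊗ ℂ`, not claimed algebraic or not).
[cite: Gordon1999HodgeAVSurvey, 7.4–7.6.1] -/
theorem exists_exceptional_prod_pairFlip_of_finrank_lt (h01 : i₀ ≠ i₁) (hI : ∀ j, j = i₀ ∨ j = i₁)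
    (hflip : ∀ s : K i₁ →+* ℂ, ∃ σ : ℂ ≃+* ℂ, σ • s = (starRingAut : ℂ ≃+* ℂ) • s ∧
      ∀ t : K i₁ →+* ℂ, t ≠ s → t ≠ (starRingAut : ℂ ≃+* ℂ) • s → σ • t = t)
    (hlt : finrank ℚ (K i₀) < finrank ℚ (K i₁)) (hA : ∀ i, IsCMTypeRealisation (Φ i) (A i) (ι i) (θ i))
    (hs : ∀ i, (A i).IsSimple) (hniso : ∀ i i', i ≠ i' → ¬ AbelianVariety.IsIsogenous (A i) (A i'))
    (hdeg : ¬ IsNondegenerate (Φ i₀)) :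
    ∃ (N : ℕ) (π : Fin N → I) (m : ℕ) (c : complexBetti (⨁ fun j : Fin N => A (π j)).X (2 * m)),
      IsRationalClass c ∧
      IsOfHodgeType (⨁ fun j : Fin N => A (π j)).dim (⨁ fun j : Fin N => A (π j)).X (2 * m) m m c ∧
      c ∉ divisorClassesSpan (⨁ fun j : Fin N => A (π j)).X (⨁ fun j : Fin N => A (π j)).dim m :=
  CMAlgebra.exists_exceptional_prod_of_not_isNondegenerateFamily
    (CMAlgebra.isSeparatingFamily_of_isSimple_of_pairwise_not_isIsogenous hA hs hniso)
    (fun h => hdeg ((isNondegenerateFamily_iff_pairFlip_of_finrank_lt h01 hI hflip hlt).1 h)) hA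

end Varieties

end Summit.HodgeConjecture.CorCM

end
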